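import Literature.NumberTheory.PAdicHodge.AinfWeierstrassRamifiedTorsionNorm
import Literature.NumberTheory.EllipticCurves.SupersingularFormalMulFrobenius
import Literature.NumberTheory.EllipticCurves.HasseInvariantTraceProofs
import Literature.NumberTheory.EllipticCurves.TateModuleProjSurjectiveProofs
import HarnessLib

/-!
# The `p`-torsion witness in `T_pŴ(𝒪_{ℂ_F})` for the `𝒪_F`-model, and exact height `2` when `𝓀_F ≅ 𝔽_p` (proofs only)

Topic `Literature/NumberTheory/PAdicHodge`; namespace `Literature.NumberTheory.PAdicHodge.AinfTop`. THEOREMS ONLY. Sequel of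
`AinfWeierstrassRamifiedTorsionNorm` (`exists_torsionPt_norm_p_lt_norm_pow`: a `p`-torsion point `u ∈ Ŵ(𝔪_{ℂ_F})` of the `𝒪_F`-model with
`‖p‖ < ‖u‖^p`, under exact height `2` of the reduction).

* `coeff_sq_formalMul_prime_reduction_ne_zero` — **exact height `2` is automatic when `𝓀_F ≅ 𝔽_p` and `p ≥ 5`**: for the `𝒪_F`-model
  with `Δ ∈ 𝒪_Fˣ`, `A_p(W mod 𝔪) = 0` and a ring isomorphism `𝓀_F ≃+* ZMod p`, `[X^{p²}][p]˜ ≠ 0` (indeed `= −1`: `a_p = 0` for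
  `p ≥ 5`, tree `coeff_sq_formalMul_ringChar_of_tr_eq_zero`). This is the case of the potentially supersingular Kodaira cells over
  `F = ℚ_p(p^{1/e})` (totally ramified).
* **`exists_tatePtO_norm_p_lt_norm_pow`** — some `τ ∈ TatePtO F W p = T_pŴ(𝒪_{ℂ_F})` has first coordinate `u₁` with `u₁ ≠ 0`,
  `‖p‖ < ‖u₁‖^p`: the good `p`-torsion point of `AinfWeierstrassRamifiedTorsionNorm` (from `E(F̄)[p]`), lifted to `T_pE(F̄)`
  (`proj_surjective_of_isAlgClosed_holds`), transported to `T_pE(ℂ_F)` (`tateModuleMapEquiv`) and to `T_pŴ(𝒪_{ℂ_F})`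
  (`tateModuleCEquivTatePtOSS`).

BSD context: route EdixhovenFibreFiveSeven, crux K★ `stmt-BirchSwinnertonDyer-22226`, road item (R1): this is the point witness fed to the
η-transversality criterion for the ramified good models (memo `Lines/kato-lever-hDR-R1-torsion-witness.md`). BSD is not proved by any of
this.

## References
* J.-P. Serre, Invent. Math. 15 (1972), §1.11. [Serre1972]
* J. H. Silverman, *The Arithmetic of Elliptic Curves* (2009), III.6.4, III.§7, IV.7.5, VII.2.2. [SilvermanAEC2009]
-/

noncomputable section

open scoped Classical NNReal
open Field ValuativeRel Polynomial

namespace Literature.NumberTheory.PAdicHodge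

open Literature.NumberTheory.GaloisRepresentations
open Literature.NumberTheory.GaloisRepresentations.IsNonarchimedeanLocalField
open Literature.NumberTheory.GaloisRepresentations.LubinTate
open Literature.NumberTheory.EllipticCurves Literature.NumberTheory.EllipticCurves.FormalGroupChart

namespace AinfTop

variable {F : Type} [Field F] [ValuativeRel F] [TopologicalSpace F] [IsNonarchimedeanLocalField F]
  {p : ℕ} [Fact p.Prime] (W : WeierstrassCurve (LTCoeff F))

/-- **Exact height `2` of the reduction when `𝓀_F ≅ 𝔽_p`, `p ≥ 5`**: `[X^{p²}][p]˜ ≠ 0` for the `𝒪_F`-model with `Δ ∈ 𝒪_Fˣ` and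
`A_p(W mod 𝔪) = 0` (`a_p = 0` by Hasse's bound, `[p]˜ = ĩ(X^{p²})`). [cite: SilvermanAEC2009, IV.7.5] -/
theorem coeff_sq_formalMul_prime_reduction_ne_zero (e : 𝓀[F] ≃+* ZMod p) (hp5 : 5 ≤ p) (hΔ : IsUnit W.Δ)
    (hA : (W.map (redCoeff F)).hasseCoeff p = 0) :
    PowerSeries.coeff (p ^ 2) ((W.map (redCoeff F)).formalMul p) ≠ 0 := by
  have hp : p.Prime := Fact.out
  have hp2 : p ≠ 2 := by omega
  set E : WeierstrassCurve (ZMod p) := (W.map (redCoeff F)).map e.toRingHom with hE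
  haveI : E.IsElliptic := ⟨by rw [hE, WeierstrassCurve.map_Δ, WeierstrassCurve.map_Δ]; exact (hΔ.map _).map _⟩
  have hAE : E.hasseCoeff p = 0 := by rw [hE, WeierstrassCurve.map_hasseCoeff, hA, map_zero]
  have htr := HasseManin.tr_eq_zero_of_dvd_of_five_le E (ZMod.card p) hp5 ((E.hasseCoeff_eq_zero_iff_dvd_tr hp2).mp hAE)
  have h := E.coeff_sq_formalMul_ringChar_of_tr_eq_zero htr
  rw [hE, ← WeierstrassCurve.map_formalMul, PowerSeries.coeff_map] at h
  intro h0
  rw [h0, map_zero] at h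
  exact one_ne_zero (neg_eq_zero.mp h.symm)

variable [CharZero F] [CharP 𝓀[F] p]

/-- **A Tate-module point with good first coordinate, for the `𝒪_F`-model**: for the good model `W` (`Δ ∈ 𝒪_Fˣ`) with supersingular
reduction of exact height `2` at the odd residue characteristic `p`, some `τ ∈ T_pŴ(𝒪_{ℂ_F})` has first coordinate `u₁ ≠ 0` with
`‖p‖ < ‖u₁‖^p` (a `p`-torsion point outside the canonical subgroup, lifted along `T_pE(F̄) → T_pE(ℂ_F) ≅ T_pŴ(𝒪_{ℂ_F})`).
[cite: Serre1972, §1.11] [cite: SilvermanAEC2009, Prop. VII.2.2] -/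
theorem exists_tatePtO_norm_p_lt_norm_pow (hp2 : p ≠ 2) (hΔ : IsUnit W.Δ) (hA : (W.map (redCoeff F)).hasseCoeff p = 0)
    (hht : PowerSeries.coeff (p ^ 2) ((W.map (redCoeff F)).formalMul p) ≠ 0) :
    ∃ τ : TatePtO F W p, ((((TateModule.proj p 1 τ).val : (maxNilIdealC F).toIdeal) : CBall F) : CompletedAlgClosure F) ≠ 0 ∧
      ‖(p : CompletedAlgClosure F)‖ <
        ‖((((TateModule.proj p 1 τ).val : (maxNilIdealC F).toIdeal) : CBall F) : CompletedAlgClosure F)‖ ^ p := by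
  have hp : p.Prime := Fact.out
  haveI hEC : (curveOver (CompletedAlgClosure F) W).IsElliptic := isElliptic_curveOverC_O (F := F) hΔ
  set EF : WeierstrassCurve F := W.map (algebraMap (LTCoeff F) F) with hEF
  haveI : EF.IsElliptic := ⟨by rw [hEF, WeierstrassCurve.map_Δ]; exact hΔ.map _⟩
  set Eb : WeierstrassCurve (AlgebraicClosure F) := EF.baseChange (AlgebraicClosure F) with hEb
  haveI : CharZero (AlgebraicClosure F) :=
    charZero_of_injective_algebraMap (algebraMap F (AlgebraicClosure F)).injective
  have hpK : ((p : ℕ) : AlgebraicClosure F) ≠ 0 := Nat.cast_ne_zero.mpr hp.ne_zero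
  -- the `p`-torsion of `E(F̄)` and its image in `E₁(ℂ_F)`
  set T := AddSubgroup.torsionBy Eb.toAffine.Point (p : ℤ) with hT
  have hcard : Nat.card T = p ^ 2 := WeierstrassCurve.card_torsionBy_eq_sq (E := Eb) hpK
  haveI : Finite T := Nat.finite_of_card_ne_zero (by rw [hcard]; exact pow_ne_zero _ hp.ne_zero)
  haveI : Fintype T := Fintype.ofFinite T
  have hbar := baseChange_map_algClosureToC_eq_curveOver W
  set ψ : Eb.toAffine.Point →+ (curveOver (CompletedAlgClosure F) W).toAffine.Point :=
    (WeierstrassCurve.Affine.Point.congrEquiv hbar).toAddMonoidHom.comp (Eb.mapPointHom (algClosureToC F)) with hψ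
  have hψinj : Function.Injective ψ :=
    (WeierstrassCurve.Affine.Point.congrEquiv hbar).injective.comp (WeierstrassCurve.mapPointHom_injective _ _)
  have hss := mem_kernel_of_pow_prime_smul_eq_zero_ssO (F := F) (W := W) hp2 hΔ hA
  have hker : ∀ P : T, ψ P.1 ∈ kernel (NormedField.valuation (K := CompletedAlgClosure F)) (curveOver (CompletedAlgClosure F) W) :=
    fun P => hss 1 (ψ P.1) (by rw [pow_one, ← map_nsmul, AddSubgroup.torsionBy.nsmul_iff.mp P.2, map_zero])
  set φ : T → CompletedAlgClosure F := fun P => (ψ P.1).zCoord with hφ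
  have hφinj : Function.Injective φ := by
    intro P Q hPQ
    have h1 : kernelEquivPt (CompletedAlgClosure F) W ⟨ψ P.1, hker P⟩ = kernelEquivPt (CompletedAlgClosure F) W ⟨ψ Q.1, hker Q⟩ := by
      apply WeierstrassCurve.Pt.ext
      rw [kernelEquivPt_apply_val, kernelEquivPt_apply_val]
      exact Subtype.ext (Subtype.ext hPQ)
    have h2 := congrArg Subtype.val ((kernelEquivPt (CompletedAlgClosure F) W).injective h1)
    exact Subtype.ext (hψinj h2)
  -- the finset of `z`-coordinates and a good root
  set S : Finset (CompletedAlgClosure F) := Finset.univ.image φ with hS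
  have hS0 : (0 : CompletedAlgClosure F) ∈ S := by
    refine Finset.mem_image.mpr ⟨⟨0, (AddSubgroup.torsionBy Eb.toAffine.Point (p : ℤ)).zero_mem⟩, Finset.mem_univ _, ?_⟩
    simp only [hφ, map_zero, WeierstrassCurve.Affine.Point.zCoord_zero]
  have hScard : S.card = p ^ 2 := by
    rw [hS, Finset.card_image_of_injective _ hφinj, Finset.card_univ, ← Nat.card_eq_fintype_card, hcard]
  have hSroots : ∀ s ∈ S, ∃ u : (maxNilIdealC F).toIdeal, ((u : CBall F) : CompletedAlgClosure F) = s ∧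
      (evalPt₁ (maxNilIdealC F) (W.formalMul p) (W.constantCoeff_formalMul p) u : CBall F) = 0 := by
    intro s hs
    obtain ⟨P, -, rfl⟩ := Finset.mem_image.mp hs
    refine ⟨zPt (ψ P.1) (hker P), rfl, ?_⟩
    have hnsmul : p • (⟨ψ P.1, hker P⟩ : kernel (NormedField.valuation (K := CompletedAlgClosure F))
        (curveOver (CompletedAlgClosure F) W)) = 0 := by
      apply Subtype.ext
      rw [AddSubmonoidClass.coe_nsmul, ZeroMemClass.coe_zero, ← map_nsmul, AddSubgroup.torsionBy.nsmul_iff.mp P.2, map_zero]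
    have h := congrArg WeierstrassCurve.Pt.val (congrArg (kernelEquivPt (CompletedAlgClosure F) W) hnsmul)
    rw [map_nsmul, map_zero, WeierstrassCurve.Pt.val_nsmul, kernelEquivPt_apply_val, WeierstrassCurve.Pt.val_zero] at h
    exact congrArg Subtype.val h
  obtain ⟨s, hs, -, hlt⟩ := exists_norm_p_lt_norm_pow_of_roots W hp2 hA hht S hS0 hScard hSroots
  obtain ⟨hs0, hsS⟩ := Finset.mem_erase.mp hs
  obtain ⟨P, -, hPs⟩ := Finset.mem_image.mp hsS
  -- lift `P` to `T_pE(F̄)` and transport to `T_pŴ(𝒪_{ℂ_F})`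
  have hP1 : (P.1 : EF.geomPoints) ∈ EF.geomTorsion ((p ^ 1 : ℕ) : ℤ) := by rw [pow_one]; exact P.2
  obtain ⟨a, ha⟩ := WeierstrassCurve.proj_surjective_of_isAlgClosed_holds EF p 1 hP1
  set aC : TateModule (curveOver (CompletedAlgClosure F) W).toAffine.Point p :=
    TateModule.mapEquiv p (WeierstrassCurve.Affine.Point.congrEquiv hbar)
      (tateModuleMapEquiv (algClosureToC F) Eb p hpK a) with haC
  have hproj : TateModule.proj p 1 aC = ψ P.1 := by
    rw [haC, TateModule.proj_mapEquiv, proj_tateModuleMapEquiv]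
    change ψ (TateModule.proj p 1 a) = ψ P.1
    exact congrArg ψ ha
  refine ⟨tateModuleCEquivTatePtOSS F W p hp2 hΔ hA aC, ?_, ?_⟩
  all_goals
    have hval : ((((TateModule.proj p 1 (tateModuleCEquivTatePtOSS F W p hp2 hΔ hA aC)).val : (maxNilIdealC F).toIdeal) :
        CBall F) : CompletedAlgClosure F) = (ψ P.1).zCoord := by
      change ((((TateModule.proj p 1 (tateModuleToPt W p hss aC)).val : (maxNilIdealC F).toIdeal) : CBall F) :
        CompletedAlgClosure F) = _
      rw [coe_proj_tateModuleToPt, hproj]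
    rw [hval]
  · have h := hs0
    rw [← hPs] at h
    exact h
  · have h := hlt
    rw [← hPs] at h
    exact h

end AinfTop

end Literature.NumberTheory.PAdicHodge

end
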